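import Mathlib

/-!
# Pair completion by constant transvections (`stub_pairCompletion`)

`Matrix.transvection i j c = 1 + Matrix.single i j c` is the elementary matrix `E_ij(c)`
(`3 × 3` over `ℂ`).  Given nonzero `u w : Fin 3 → ℂ` with `wᵀ u = 0` we produce a
product `g` of at most `12` (in fact `7`) off-diagonal constant transvections with first
column `u` (`g e₀ = u`) and `wᵀ g = e₂ᵀ`; then `g · E_02(x) · g⁻¹ = 1 + x · u wᵀ`, which
is how line `Sketch` turns a square-zero chain factor back into elementary letters.

Construction: `g = A · B` (letters of `A` followed by letters of `B`) with `wᵀ A = e₂ᵀ`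
(row normalisation of `w`, at most `4` letters), and, for `u' := A⁻¹ u` (nonzero, with
`u'₂ = e₂ᵀ A⁻¹ u = wᵀ u = 0`), `B e₀ = u'` and `e₂ᵀ B = e₂ᵀ` (at most `3` letters
`E_ij` with `i, j ∈ {0, 1}`, which fix the row vector `e₂ᵀ`).  Then `g e₀ = A u' = u`
and `wᵀ g = e₂ᵀ B = e₂ᵀ`.
-/

set_option linter.dupNamespace false

namespace Summit.ValiantsHypothesis.ValiantsHypothesis.Theorems.WordPerSuperQuartic

open Matrix

/-- Coordinates of the left action of a transvection on a column vector:
`E_ij(c) · x` adds `c · x_j` to coordinate `i`. -/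
private theorem transvection_mulVec_apply (i j : Fin 3) (c : ℂ) (x : Fin 3 → ℂ) (k : Fin 3) :
    (transvection i j c *ᵥ x) k = x k + if k = i then c * x j else 0 := by
  simp only [transvection, add_mulVec, one_mulVec, single_mulVec, Pi.add_apply,
    Function.update_apply, Pi.zero_apply]

/-- The transpose of `E_ij(c)` is `E_ji(c)`. -/
private theorem transpose_transvection (i j : Fin 3) (c : ℂ) :
    (transvection i j c)ᵀ = transvection j i c := by
  simp only [transvection, transpose_add, transpose_one, transpose_single]

/-- Coordinates of the right action of a transvection on a row vector:
`x · E_ij(c)` adds `c · x_i` to coordinate `j`. -/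
private theorem vecMul_transvection_apply (i j : Fin 3) (c : ℂ) (x : Fin 3 → ℂ) (k : Fin 3) :
    (x ᵥ* transvection i j c) k = x k + if k = j then c * x i else 0 := by
  rw [← mulVec_transpose, transpose_transvection, transvection_mulVec_apply]

/-- A product of off-diagonal transvections has determinant `1`. -/
private theorem det_prod_transvection (l : List (Fin 3 × Fin 3 × ℂ))
    (hl : ∀ t ∈ l, t.1 ≠ t.2.1) :
    ((l.map (fun t => transvection t.1 t.2.1 t.2.2)).prod).det = 1 := by
  induction l with
  | nil => simp
  | cons t l ih =>
    rw [List.map_cons, List.prod_cons, det_mul, det_transvection_of_ne _ _ (hl t (by simp)),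
      one_mul]
    exact ih (fun s hs => hl s (List.mem_cons_of_mem _ hs))

/-- **Row normalisation.**  Every nonzero row vector `w` is sent to `e₂ᵀ` by right
multiplication with at most `4` off-diagonal constant transvections. -/
private theorem row_normalisation (w : Fin 3 → ℂ) (hw : w ≠ 0) :
    ∃ l : List (Fin 3 × Fin 3 × ℂ), l.length ≤ 4 ∧ (∀ t ∈ l, t.1 ≠ t.2.1) ∧
      w ᵥ* (l.map (fun t => transvection t.1 t.2.1 t.2.2)).prod = Pi.single 2 1 := by
  rcases ne_or_eq (w 2) 0 with hr | hr
  · -- `(p,q,r) → (0,q,r) → (0,1,r) → (0,1,1) → (0,0,1)`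
    refine ⟨[(2, 0, -w 0 / w 2), (2, 1, (1 - w 1) / w 2), (1, 2, 1 - w 2), (2, 1, -1)],
      le_rfl, by simp, ?_⟩
    ext k
    fin_cases k <;>
      simp only [List.map_cons, List.map_nil, List.prod_cons, List.prod_nil, ← vecMul_vecMul,
        vecMul_one, vecMul_transvection_apply] <;> simp <;> field_simp <;> ring
  rcases ne_or_eq (w 1) 0 with hq | hq
  · -- `r = 0`: `(p,q,0) → (p,q,1) → (0,q,1) → (0,0,1)`
    refine ⟨[(1, 2, 1 / w 1), (2, 0, -w 0), (2, 1, -w 1)], by simp, by simp, ?_⟩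
    ext k
    fin_cases k <;>
      simp only [List.map_cons, List.map_nil, List.prod_cons, List.prod_nil, ← vecMul_vecMul,
        vecMul_one, vecMul_transvection_apply] <;> simp [hr]
    · field_simp
      ring
    · field_simp
      ring
    · field_simp
  · -- `r = q = 0`, so `p ≠ 0`: `(p,0,0) → (p,0,1) → (0,0,1)`
    have hp : w 0 ≠ 0 := by
      intro hp
      apply hw
      ext k
      fin_cases k <;> simp [hp, hq, hr]
    refine ⟨[(0, 2, 1 / w 0), (2, 0, -w 0)], by simp, by simp, ?_⟩
    ext k
    fin_cases k <;>
      simp only [List.map_cons, List.map_nil, List.prod_cons, List.prod_nil, ← vecMul_vecMul,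
        vecMul_one, vecMul_transvection_apply] <;> simp [hr, hq]
    · field_simp
      ring
    · field_simp

/-- **Column completion.**  Every nonzero column vector `u'` with `u'₂ = 0` is the first column
of a product of at most `3` off-diagonal constant transvections `E_ij(c)` with `i, j ∈ {0, 1}`,
which therefore fixes the row vector `e₂ᵀ`. -/
private theorem col_completion (u' : Fin 3 → ℂ) (hu' : u' ≠ 0) (hu'2 : u' 2 = 0) :
    ∃ l : List (Fin 3 × Fin 3 × ℂ), l.length ≤ 3 ∧ (∀ t ∈ l, t.1 ≠ t.2.1) ∧
      (l.map (fun t => transvection t.1 t.2.1 t.2.2)).prod *ᵥ (Pi.single 0 1) = u' ∧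
      Pi.single 2 1 ᵥ* (l.map (fun t => transvection t.1 t.2.1 t.2.2)).prod = Pi.single 2 1 := by
  rcases ne_or_eq (u' 0) 0 with ha | ha
  · -- `e₀ → (1,1,0) → (a,1,0) → (a,b,0)` (rightmost letter acts first)
    refine ⟨[(1, 0, (u' 1 - 1) / u' 0), (0, 1, u' 0 - 1), (1, 0, 1)], le_rfl, by simp, ?_, ?_⟩
    · ext k
      fin_cases k <;>
        simp only [List.map_cons, List.map_nil, List.prod_cons, List.prod_nil, ← mulVec_mulVec,
          one_mulVec, transvection_mulVec_apply] <;> simp [hu'2]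
      field_simp
      ring
    · ext k
      fin_cases k <;>
        simp only [List.map_cons, List.map_nil, List.prod_cons, List.prod_nil, ← vecMul_vecMul,
          vecMul_one, vecMul_transvection_apply] <;> simp
  · -- `a = 0`, so `b ≠ 0`: `e₀ → (1,b,0) → (0,b,0)`
    have hb : u' 1 ≠ 0 := by
      intro hb
      apply hu'
      ext k
      fin_cases k <;> simp [ha, hb, hu'2]
    refine ⟨[(0, 1, -1 / u' 1), (1, 0, u' 1)], by simp, by simp, ?_, ?_⟩
    · ext k
      fin_cases k <;>
        simp only [List.map_cons, List.map_nil, List.prod_cons, List.prod_nil, ← mulVec_mulVec,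
          one_mulVec, transvection_mulVec_apply] <;> simp [ha, hu'2]
      field_simp
      ring
    · ext k
      fin_cases k <;>
        simp only [List.map_cons, List.map_nil, List.prod_cons, List.prod_nil, ← vecMul_vecMul,
          vecMul_one, vecMul_transvection_apply] <;> simp

/-- E2 — **pair completion**: for nonzero `u w : Fin 3 → ℂ` with `wᵀ u = 0` there is a
product `g` of at most `12` off-diagonal constant transvections with `g e₀ = u` and
`wᵀ g = e₂ᵀ` (so that `g · E_02(x) · g⁻¹ = 1 + x · u wᵀ`). -/
theorem stub_pairCompletion (u w : Fin 3 → ℂ) (hu : u ≠ 0) (hw : w ≠ 0) (huw : w ⬝ᵥ u = 0) :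
    ∃ l : List (Fin 3 × Fin 3 × ℂ), l.length ≤ 12 ∧ (∀ t ∈ l, t.1 ≠ t.2.1) ∧
      (l.map (fun t => Matrix.transvection t.1 t.2.1 t.2.2)).prod.mulVec (Pi.single 0 1) = u ∧
      Matrix.vecMul w (l.map (fun t => Matrix.transvection t.1 t.2.1 t.2.2)).prod = Pi.single 2 1 := by
  obtain ⟨lA, hlenA, hoffA, hrowA⟩ := row_normalisation w hw
  set PA := (lA.map (fun t => transvection t.1 t.2.1 t.2.2)).prod with hPA
  have hdet : IsUnit PA.det := by
    rw [hPA, det_prod_transvection lA hoffA]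
    exact isUnit_one
  -- `u' := A⁻¹ u` is nonzero with `u'₂ = wᵀ u = 0`
  set u' := PA⁻¹ *ᵥ u with hu'
  have hAu' : PA *ᵥ u' = u := by
    rw [hu', mulVec_mulVec, mul_nonsing_inv _ hdet, one_mulVec]
  have hu'ne : u' ≠ 0 := by
    intro h
    apply hu
    rw [← hAu', h, mulVec_zero]
  have hwA : w = Pi.single 2 1 ᵥ* PA⁻¹ := by
    rw [← hrowA, vecMul_vecMul, mul_nonsing_inv _ hdet, vecMul_one]
  have hu'2 : u' 2 = 0 := by
    calc u' 2 = Pi.single 2 1 ⬝ᵥ u' := (single_one_dotProduct 2 u').symm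
      _ = (Pi.single 2 1 ᵥ* PA⁻¹) ⬝ᵥ u := by rw [hu', dotProduct_mulVec]
      _ = w ⬝ᵥ u := by rw [← hwA]
      _ = 0 := huw
  obtain ⟨lB, hlenB, hoffB, hcolB, hrowB⟩ := col_completion u' hu'ne hu'2
  refine ⟨lA ++ lB, ?_, ?_, ?_, ?_⟩
  · simp only [List.length_append]
    omega
  · intro t ht
    rcases List.mem_append.1 ht with h | h
    exacts [hoffA t h, hoffB t h]
  · rw [List.map_append, List.prod_append, ← mulVec_mulVec, hcolB, hAu']
  · rw [List.map_append, List.prod_append, ← vecMul_vecMul, hrowA, hrowB]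

end Summit.ValiantsHypothesis.ValiantsHypothesis.Theorems.WordPerSuperQuartic
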